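import Literature.Probability.LatticeModels.SRWPathSpace
import Literature.Probability.LatticeModels.DomainDiscretisation
import Mathlib.Combinatorics.SimpleGraph.Basic
import Mathlib.Analysis.SpecificLimits.Basic
import HarnessLib

/-!
# Killed simple-random-walk functionals on a subgraph of `ℤ^d`

Definition request `defn-SRWKilledWalkFunctionals` (route `SAWExcursionCardy` of
`Summits/CriticalPhenomena/SAWScalingLimit`, items `ExcursionCardyFormula`, `SlitExcursionCardy`,
`RWGreenCrossRatioLimit`, where the two functionals below are inlined as `let E` / `let Gf`).

Setting: the simple random walk of `SRWPathSpace.lean` — path space `PathSpace d = ℕ → Dir d` with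
the product law `SRW.pathLaw d` of uniform steps, positions `p + S ω j` for a walk started at `p` —
and a graph `Gr : SimpleGraph (Site d)` (typically `discreteDomainGraph Ω δ`, or that graph with a
vertex set removed). The walk is **run along `Gr`-edges and killed at its first step that is not a
`Gr`-edge** — the edge-killed version, on a general subgraph of `ℤ^d`, of the random walk killed on
leaving a set `A ⊂ ℤ^d`: Lawler 1991, §1.5 (the Green's function `G_A(x,y) = Σ_j P^x{S_j = y, τ > j}`,
symmetric "by traversing the path backwards"); Kozdron–Lawler 2005 (arXiv:math/0501189), §2.3
(`G_A` on `ℤ²`) and §2.9, Definitions 2.17–2.18 (discrete Poisson kernel `h_A(x,y)`, discrete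
excursion Poisson kernel `h_∂A(x,y)`, last-exit decomposition through `G_A`). For the induced
subgraph of `ℤ^d` on `A` the two killings agree; the route needs the subgraph version because
`discreteDomainGraph Ω δ` deletes edges, not only vertices. Everything in this file is folklore and
fully proved.

## Contents (namespace `Literature.Probability.LatticeModels.SRW`)

* `transitEvent Gr n p q`, `killedTrans Gr n p q = P[first n steps are Gr-edges, position n = q]`
  (the `n`-step transition function of the killed walk) and the **killed Green function**
  `killedGreen Gr p q = ∑' n, killedTrans Gr n p q` (`killedGreen_def`: literally the route's
  `let Gf`);
* `exitEvent Gr n p q A`, `exitTrans`, and the **excursion functional**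
  `exitAfterAvoiding Gr p q A = P[∃ n, first n steps Gr-edges, step n+1 not a Gr-edge,
  position n = q, positions 0..n avoid A]` (`exitAfterAvoiding_def`: literally the route's
  `let E`); `exitAfterAvoiding_eq_tsum`;
* finite coding by step sequences (`killedTrans_eq_card`) and **symmetry**
  `killedTrans_comm`, `killedGreen_comm` (path reversal `StepSeq.reverse`);
* `exitAfterAvoiding_mono/_nonneg/_le_one`, the ratio `E(A)/E(∅) ∈ [0,1]`
  (`exitAfterAvoiding_ratio_nonneg/_le_one`);
* the **restriction identity** `exitAfterAvoiding_of_adj_iff`: for a graph `Gr'` obtained from `Gr`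
  by deleting the vertex set `V` (`Gr'.Adj x y ↔ Gr.Adj x y ∧ x ∉ V ∧ y ∉ V`), a start `p ∉ V` and
  an exit point `q` with no `Gr`-neighbour in `V`, `E_{Gr'}(p,q,A) = E_{Gr}(p,q,A ∪ V)`; hence
  `E_Gr(V)/E_Gr(∅) · (E_{Gr'}(A)/E_{Gr'}(∅)) = E_Gr(A ∪ V)/E_Gr(∅)` (`exitAfterAvoiding_ratio_mul`);
* the Markov property at time `1` on path space (`tail`, `S_succ_eq_stepVec_add`,
  `pathLaw_map_tail`, `real_head_inter_tail`) and the **first-step (discrete harmonicity)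
  equations** in the starting point: `killedTrans_succ`, `exitTrans_succ`,
  `exitAfterAvoiding_first_step`, and `killedGreen_first_step` (under summability);
* positivity `killedGreen_pos_of_reachable` (`G(p,q) > 0` for `Gr`-connected `p, q`, `Gr ≤ zdGraph d`
  with finite support) and `one_le_killedGreen_self`;
* **summability** of `n ↦ killedTrans Gr n p q` when `Gr` has finitely many non-isolated vertices
  (`summable_killedTrans_of_finite_support`, via survival probabilities `survival`, the first-step
  equation `survival_succ`, uniform escape `survival_le_of_finite_support` and geometric decay
  `survival_mul_le_pow`), so that `killedGreen_first_step_of_finite_support` applies to the finite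
  lattice domains of the route (`finite_support_discreteDomainGraph`,
  `support_fromRel_and_notMem_subset`).

Probabilities are real numbers (`Measure.real`), as in `SRWPathSpace.lean`.
-/

noncomputable section

open MeasureTheory ProbabilityTheory Finset Set
open scoped Classical

namespace Literature.Probability.LatticeModels

namespace SRW

variable {d : ℕ}

/-! ### Events and functionals -/

/-- The event that the walk started at `p` uses only `Gr`-edges during its first `n` steps and
sits at `q` at time `n`. [folklore] -/
def transitEvent (Gr : SimpleGraph (Site d)) (n : ℕ) (p q : Site d) : Set (PathSpace d) :=
  {ω | (∀ j < n, Gr.Adj (p + S ω j) (p + S ω (j + 1))) ∧ p + S ω n = q}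

/-- The `n`-step transition function of the walk killed at its first non-`Gr` step:
`P[first n steps are Gr-edges, position n = q]`. [folklore] -/
def killedTrans [NeZero d] (Gr : SimpleGraph (Site d)) (n : ℕ) (p q : Site d) : ℝ :=
  (pathLaw d).real {ω | (∀ j < n, Gr.Adj (p + S ω j) (p + S ω (j + 1))) ∧ p + S ω n = q}

/-- The **Green function of the simple random walk run along `Gr`-edges and killed at its first
step that is not a `Gr`-edge**: `G(p,q) = Σ_n P[first n steps Gr-edges, position n = q]`, the
expected number of visits to `q` before killing (cf. `G_A` of Lawler 1991, §1.5 and Kozdron–Lawler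
2005, §2.3). As a `tsum` it is `0` by convention when the series diverges (e.g. `Gr = ℤ²` itself);
see `summable_killedTrans_of_finite_support`. [folklore] -/
def killedGreen [NeZero d] (Gr : SimpleGraph (Site d)) (p q : Site d) : ℝ :=
  ∑' n : ℕ, killedTrans Gr n p q

/-- The event that the walk from `p` uses `Gr`-edges for its first `n` steps, its step `n+1` is not
a `Gr`-edge (it is killed right after time `n`), it sits at `q` at time `n`, and its positions at
times `0, …, n` avoid `A`. [folklore] -/
def exitEvent (Gr : SimpleGraph (Site d)) (n : ℕ) (p q : Site d) (A : Set (Site d)) :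
    Set (PathSpace d) :=
  {ω | (∀ j < n, Gr.Adj (p + S ω j) (p + S ω (j + 1))) ∧ ¬ Gr.Adj (p + S ω n) (p + S ω (n + 1)) ∧
    p + S ω n = q ∧ ∀ j ≤ n, p + S ω j ∉ A}

/-- The probability of `exitEvent Gr n p q A`. [folklore] -/
def exitTrans [NeZero d] (Gr : SimpleGraph (Site d)) (n : ℕ) (p q : Site d) (A : Set (Site d)) : ℝ :=
  (pathLaw d).real (exitEvent Gr n p q A)

/-- The **excursion functional** `E_Gr(p,q,A)`: the probability that the walk from `p`, run along
`Gr`-edges and killed at its first non-`Gr` step, is killed right after a visit to `q` and avoids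
`A` up to that time (mass of `p → q` excursions avoiding `A`; `E(A)/E(∅)` is the probability that
the `p → q` excursion avoids `A`). With `A = ∅` this is the exit-at-`q` analogue (the last vertex
before killing is `q`; the convention fixed by route `SAWExcursionCardy`) of the discrete Poisson /
excursion Poisson kernels `h_A`, `h_∂A` of Kozdron–Lawler 2005, §2.9, Definitions 2.17–2.18.
[folklore] -/
def exitAfterAvoiding [NeZero d] (Gr : SimpleGraph (Site d)) (p q : Site d) (A : Set (Site d)) : ℝ :=
  (pathLaw d).real {ω | ∃ n : ℕ, (∀ j < n, Gr.Adj (p + S ω j) (p + S ω (j + 1))) ∧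
    ¬ Gr.Adj (p + S ω n) (p + S ω (n + 1)) ∧ p + S ω n = q ∧ ∀ j ≤ n, p + S ω j ∉ A}

/-- `killedTrans` is the probability of `transitEvent`. [folklore] -/
theorem killedTrans_eq [NeZero d] (Gr : SimpleGraph (Site d)) (n : ℕ) (p q : Site d) :
    killedTrans Gr n p q = (pathLaw d).real (transitEvent Gr n p q) := rfl

/-- `killedGreen` unfolded to the form inlined in route `SAWExcursionCardy` (`let Gf`). [folklore] -/
theorem killedGreen_def [NeZero d] (Gr : SimpleGraph (Site d)) (p q : Site d) :
    killedGreen Gr p q = ∑' n : ℕ, (pathLaw d).real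
      {ω | (∀ j < n, Gr.Adj (p + S ω j) (p + S ω (j + 1))) ∧ p + S ω n = q} := rfl

/-- `exitAfterAvoiding` unfolded to the form inlined in route `SAWExcursionCardy` (`let E`).
[folklore] -/
theorem exitAfterAvoiding_def [NeZero d] (Gr : SimpleGraph (Site d)) (p q : Site d) (A : Set (Site d)) :
    exitAfterAvoiding Gr p q A = (pathLaw d).real {ω | ∃ n : ℕ,
      (∀ j < n, Gr.Adj (p + S ω j) (p + S ω (j + 1))) ∧ ¬ Gr.Adj (p + S ω n) (p + S ω (n + 1)) ∧
      p + S ω n = q ∧ ∀ j ≤ n, p + S ω j ∉ A} := rfl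

/-- The event inside `exitAfterAvoiding` is the union over the killing time of the `exitEvent`s.
[folklore] -/
theorem setOf_exists_eq_iUnion_exitEvent (Gr : SimpleGraph (Site d)) (p q : Site d) (A : Set (Site d)) :
    {ω : PathSpace d | ∃ n : ℕ, (∀ j < n, Gr.Adj (p + S ω j) (p + S ω (j + 1))) ∧
      ¬ Gr.Adj (p + S ω n) (p + S ω (n + 1)) ∧ p + S ω n = q ∧ ∀ j ≤ n, p + S ω j ∉ A} =
      ⋃ n, exitEvent Gr n p q A := by
  ext ω; simp [exitEvent]

/-! ### Dependence on finitely many steps, measurability -/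

/-- Paths agreeing on the steps `< m` have the same positions up to time `m`. [folklore] -/
theorem S_congr {ω ω' : PathSpace d} {m : ℕ} (h : ∀ i < m, ω i = ω' i) {j : ℕ} (hj : j ≤ m) :
    S ω j = S ω' j :=
  dependsOn_incr (Finset.range j) fun l hl =>
    h l (lt_of_lt_of_le (Finset.mem_range.1 (Finset.mem_coe.1 hl)) hj)

/-- `transitEvent Gr n p q` depends only on the first `n` steps. [folklore] -/
theorem dependsOn_transitEvent (Gr : SimpleGraph (Site d)) (n : ℕ) (p q : Site d) :
    DependsOn (· ∈ transitEvent Gr n p q) (Finset.range n : Set ℕ) := by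
  intro ω ω' h
  have h' : ∀ i < n, ω i = ω' i := fun i hi => h i (Finset.mem_coe.2 (Finset.mem_range.2 hi))
  simp only [transitEvent, Set.mem_setOf_eq]
  rw [S_congr h' le_rfl]
  refine propext (and_congr_left fun _ => forall₂_congr fun j hj => ?_)
  rw [S_congr h' hj.le, S_congr h' (Nat.succ_le_of_lt hj)]

/-- `exitEvent Gr n p q A` depends only on the first `n + 1` steps. [folklore] -/
theorem dependsOn_exitEvent (Gr : SimpleGraph (Site d)) (n : ℕ) (p q : Site d) (A : Set (Site d)) :
    DependsOn (· ∈ exitEvent Gr n p q A) (Finset.range (n + 1) : Set ℕ) := by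
  intro ω ω' h
  have h' : ∀ i < n + 1, ω i = ω' i := fun i hi => h i (Finset.mem_coe.2 (Finset.mem_range.2 hi))
  simp only [exitEvent, Set.mem_setOf_eq]
  rw [S_congr h' (Nat.le_succ n), S_congr h' le_rfl]
  refine propext ⟨fun ⟨h1, h2, h3, h4⟩ => ⟨fun j hj => ?_, h2, h3, fun j hj => ?_⟩,
    fun ⟨h1, h2, h3, h4⟩ => ⟨fun j hj => ?_, h2, h3, fun j hj => ?_⟩⟩
  · rw [← S_congr h' (by omega : j ≤ n + 1), ← S_congr h' (by omega : j + 1 ≤ n + 1)]; exact h1 j hj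
  · rw [← S_congr h' (by omega : j ≤ n + 1)]; exact h4 j hj
  · rw [S_congr h' (by omega : j ≤ n + 1), S_congr h' (by omega : j + 1 ≤ n + 1)]; exact h1 j hj
  · rw [S_congr h' (by omega : j ≤ n + 1)]; exact h4 j hj

/-- `transitEvent` is measurable. [folklore] -/
theorem measurableSet_transitEvent (Gr : SimpleGraph (Site d)) (n : ℕ) (p q : Site d) :
    MeasurableSet (transitEvent Gr n p q) :=
  measurableSet_of_dependsOn (dependsOn_transitEvent Gr n p q)

/-- `exitEvent` is measurable. [folklore] -/
theorem measurableSet_exitEvent (Gr : SimpleGraph (Site d)) (n : ℕ) (p q : Site d) (A : Set (Site d)) :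
    MeasurableSet (exitEvent Gr n p q A) :=
  measurableSet_of_dependsOn (dependsOn_exitEvent Gr n p q A)

/-- Distinct killing times give disjoint `exitEvent`s. [folklore] -/
theorem disjoint_exitEvent (Gr : SimpleGraph (Site d)) (p q : Site d) (A : Set (Site d)) :
    Pairwise (Function.onFun Disjoint fun n => exitEvent Gr n p q A) := by
  intro n m hnm
  wlog hlt : n < m generalizing n m
  · exact (this hnm.symm (lt_of_le_of_ne (not_lt.1 hlt) hnm.symm)).symm
  refine Set.disjoint_left.2 fun ω hn hm => ?_
  exact hn.2.1 (hm.1 n hlt)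

/-- **`E(p,q,A) = Σ_n P[exitEvent n]`** (countable additivity over the killing time). [folklore] -/
theorem exitAfterAvoiding_eq_tsum [NeZero d] (Gr : SimpleGraph (Site d)) (p q : Site d) (A : Set (Site d)) :
    exitAfterAvoiding Gr p q A = ∑' n, exitTrans Gr n p q A := by
  rw [exitAfterAvoiding, setOf_exists_eq_iUnion_exitEvent, measureReal_def,
    measure_iUnion (disjoint_exitEvent Gr p q A) (measurableSet_exitEvent Gr · p q A),
    ENNReal.tsum_toReal_eq fun n => measure_ne_top _ _]
  rfl

/-- The series `Σ_n P[exitEvent n]` converges (its sum is a probability). [folklore] -/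
theorem summable_exitTrans [NeZero d] (Gr : SimpleGraph (Site d)) (p q : Site d) (A : Set (Site d)) :
    Summable fun n => exitTrans Gr n p q A := by
  refine ENNReal.summable_toReal ?_
  rw [← measure_iUnion (disjoint_exitEvent Gr p q A) (measurableSet_exitEvent Gr · p q A)]
  exact measure_ne_top _ _

/-! ### Elementary bounds; the ratio `E(A)/E(∅)` -/

/-- `0 ≤ killedTrans`. [folklore] -/
theorem killedTrans_nonneg [NeZero d] (Gr : SimpleGraph (Site d)) (n : ℕ) (p q : Site d) :
    0 ≤ killedTrans Gr n p q := measureReal_nonneg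

/-- `killedTrans ≤ 1`. [folklore] -/
theorem killedTrans_le_one [NeZero d] (Gr : SimpleGraph (Site d)) (n : ℕ) (p q : Site d) :
    killedTrans Gr n p q ≤ 1 := measureReal_le_one

/-- `0 ≤ killedGreen`. [folklore] -/
theorem killedGreen_nonneg [NeZero d] (Gr : SimpleGraph (Site d)) (p q : Site d) :
    0 ≤ killedGreen Gr p q := tsum_nonneg fun n => killedTrans_nonneg Gr n p q

/-- `0 ≤ exitTrans`. [folklore] -/
theorem exitTrans_nonneg [NeZero d] (Gr : SimpleGraph (Site d)) (n : ℕ) (p q : Site d) (A : Set (Site d)) :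
    0 ≤ exitTrans Gr n p q A := measureReal_nonneg

/-- `0 ≤ E(p,q,A)`. [folklore] -/
theorem exitAfterAvoiding_nonneg [NeZero d] (Gr : SimpleGraph (Site d)) (p q : Site d) (A : Set (Site d)) :
    0 ≤ exitAfterAvoiding Gr p q A := measureReal_nonneg

/-- `E(p,q,A) ≤ 1`. [folklore] -/
theorem exitAfterAvoiding_le_one [NeZero d] (Gr : SimpleGraph (Site d)) (p q : Site d) (A : Set (Site d)) :
    exitAfterAvoiding Gr p q A ≤ 1 := measureReal_le_one

/-- **Monotonicity in the avoided set**: `A ⊆ B → E(p,q,B) ≤ E(p,q,A)`. [folklore] -/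
theorem exitAfterAvoiding_mono [NeZero d] (Gr : SimpleGraph (Site d)) (p q : Site d) {A B : Set (Site d)}
    (hAB : A ⊆ B) : exitAfterAvoiding Gr p q B ≤ exitAfterAvoiding Gr p q A := by
  refine measureReal_mono ?_
  rintro ω ⟨n, h1, h2, h3, h4⟩
  exact ⟨n, h1, h2, h3, fun j hj hA => h4 j hj (hAB hA)⟩

/-- `E(p,q,A) ≤ E(p,q,∅)`. [folklore] -/
theorem exitAfterAvoiding_le_empty [NeZero d] (Gr : SimpleGraph (Site d)) (p q : Site d) (A : Set (Site d)) :
    exitAfterAvoiding Gr p q A ≤ exitAfterAvoiding Gr p q ∅ :=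
  exitAfterAvoiding_mono Gr p q (Set.empty_subset A)

/-- The avoidance probability `E(A)/E(∅)` is `≥ 0`. [folklore] -/
theorem exitAfterAvoiding_ratio_nonneg [NeZero d] (Gr : SimpleGraph (Site d)) (p q : Site d) (A : Set (Site d)) :
    0 ≤ exitAfterAvoiding Gr p q A / exitAfterAvoiding Gr p q ∅ :=
  div_nonneg (exitAfterAvoiding_nonneg Gr p q A) (exitAfterAvoiding_nonneg Gr p q ∅)

/-- The avoidance probability `E(A)/E(∅)` is `≤ 1`. [folklore] -/
theorem exitAfterAvoiding_ratio_le_one [NeZero d] (Gr : SimpleGraph (Site d)) (p q : Site d) (A : Set (Site d)) :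
    exitAfterAvoiding Gr p q A / exitAfterAvoiding Gr p q ∅ ≤ 1 :=
  div_le_one_of_le₀ (exitAfterAvoiding_le_empty Gr p q A) (exitAfterAvoiding_nonneg Gr p q ∅)

/-! ### Restriction to a graph with deleted vertices -/

/-- The slit graph of route `SAWExcursionCardy`, `SimpleGraph.fromRel fun x y => Gr.Adj x y ∧ x ∉ V ∧ y ∉ V`,
is `Gr` with the vertex set `V` deleted: its adjacency is `Gr.Adj x y ∧ x ∉ V ∧ y ∉ V` (the shape of
hypothesis `hGr'` below). [folklore] -/
theorem fromRel_adj_and_notMem_iff (Gr : SimpleGraph (Site d)) (V : Set (Site d)) (x y : Site d) :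
    (SimpleGraph.fromRel fun x y => Gr.Adj x y ∧ x ∉ V ∧ y ∉ V).Adj x y ↔
      Gr.Adj x y ∧ x ∉ V ∧ y ∉ V := by
  rw [SimpleGraph.fromRel_adj]
  constructor
  · rintro ⟨-, h | h⟩
    · exact h
    · exact ⟨h.1.symm, h.2.2, h.2.1⟩
  · intro h
    exact ⟨h.1.ne, Or.inl h⟩

/-- The slit graph is a subgraph of `Gr`. [folklore] -/
theorem fromRel_and_notMem_le (Gr : SimpleGraph (Site d)) (V : Set (Site d)) :
    (SimpleGraph.fromRel fun x y => Gr.Adj x y ∧ x ∉ V ∧ y ∉ V) ≤ Gr :=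
  fun x y h => ((fromRel_adj_and_notMem_iff Gr V x y).1 h).1

/-- **Restriction identity.** Let `Gr'` be `Gr` with the vertex set `V` deleted
(`Gr'.Adj x y ↔ Gr.Adj x y ∧ x ∉ V ∧ y ∉ V`, e.g. the slit graph of `fromRel_adj_and_notMem_iff`),
let the start `p` lie off `V` and let the exit point `q` have no `Gr`-neighbour in `V`. Then the
`Gr'`-excursions `p → q` avoiding `A` are exactly the `Gr`-excursions `p → q` avoiding `A ∪ V`:
`E_{Gr'}(p,q,A) = E_{Gr}(p,q,A ∪ V)`. (The hypothesis on `q` rules out `Gr`-steps from `q` into `V`,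
which kill the `Gr'`-walk but not the `Gr`-walk.) [folklore] -/
theorem exitAfterAvoiding_of_adj_iff [NeZero d] {Gr Gr' : SimpleGraph (Site d)} {V : Set (Site d)}
    (hGr' : ∀ x y, Gr'.Adj x y ↔ Gr.Adj x y ∧ x ∉ V ∧ y ∉ V) {p q : Site d} (hp : p ∉ V)
    (hq : ∀ s ∈ V, ¬ Gr.Adj q s) (A : Set (Site d)) :
    exitAfterAvoiding Gr' p q A = exitAfterAvoiding Gr p q (A ∪ V) := by
  unfold exitAfterAvoiding
  congr 1
  ext ω
  simp only [Set.mem_setOf_eq, Set.mem_union, not_or]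
  constructor
  · rintro ⟨n, h1, h2, h3, h4⟩
    -- positions up to time `n` avoid `V`
    have hS : ∀ j ≤ n, p + S ω j ∉ V := by
      intro j hj
      rcases Nat.lt_or_ge j n with hjn | hjn
      · exact ((hGr' _ _).1 (h1 j hjn)).2.1
      · obtain rfl : j = n := le_antisymm hj hjn
        rcases Nat.eq_zero_or_pos j with rfl | hpos
        · simpa using hp
        · have := ((hGr' _ _).1 (h1 (j - 1) (by omega))).2.2
          rwa [Nat.sub_add_cancel hpos] at this
    refine ⟨n, fun j hj => ((hGr' _ _).1 (h1 j hj)).1, fun hadj => h2 ?_, h3,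
      fun j hj => ⟨h4 j hj, hS j hj⟩⟩
    refine (hGr' _ _).2 ⟨hadj, hS n le_rfl, fun hmem => ?_⟩
    rw [h3] at hadj
    exact hq _ hmem hadj
  · rintro ⟨n, h1, h2, h3, h4⟩
    refine ⟨n, fun j hj => (hGr' _ _).2 ⟨h1 j hj, (h4 j hj.le).2, (h4 (j + 1) hj).2⟩,
      fun hadj => h2 ((hGr' _ _).1 hadj).1, h3, fun j hj => (h4 j hj).1⟩

/-- With `Gr'`, `p`, `q` as in `exitAfterAvoiding_of_adj_iff`: `E_{Gr'}(p,q,∅) = E_{Gr}(p,q,V)`.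
[folklore] -/
theorem exitAfterAvoiding_of_adj_iff_empty [NeZero d] {Gr Gr' : SimpleGraph (Site d)} {V : Set (Site d)}
    (hGr' : ∀ x y, Gr'.Adj x y ↔ Gr.Adj x y ∧ x ∉ V ∧ y ∉ V) {p q : Site d} (hp : p ∉ V)
    (hq : ∀ s ∈ V, ¬ Gr.Adj q s) :
    exitAfterAvoiding Gr' p q ∅ = exitAfterAvoiding Gr p q V := by
  rw [exitAfterAvoiding_of_adj_iff hGr' hp hq, Set.empty_union]

/-- **Restriction identity for avoidance probabilities**: with `Gr'`, `p`, `q` as in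
`exitAfterAvoiding_of_adj_iff`,
`E_Gr(S)/E_Gr(∅) · (E_{Gr'}(A)/E_{Gr'}(∅)) = E_Gr(A ∪ V)/E_Gr(∅)` — the probability that the `Gr`
excursion avoids `A ∪ S` is the probability that it avoids `S` times the probability that the
excursion of the slit graph avoids `A`. [folklore] -/
theorem exitAfterAvoiding_ratio_mul [NeZero d] {Gr Gr' : SimpleGraph (Site d)} {V : Set (Site d)}
    (hGr' : ∀ x y, Gr'.Adj x y ↔ Gr.Adj x y ∧ x ∉ V ∧ y ∉ V) {p q : Site d} (hp : p ∉ V)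
    (hq : ∀ s ∈ V, ¬ Gr.Adj q s) (A : Set (Site d)) :
    exitAfterAvoiding Gr p q V / exitAfterAvoiding Gr p q ∅ *
        (exitAfterAvoiding Gr' p q A / exitAfterAvoiding Gr' p q ∅) =
      exitAfterAvoiding Gr p q (A ∪ V) / exitAfterAvoiding Gr p q ∅ := by
  rw [exitAfterAvoiding_of_adj_iff hGr' hp hq, exitAfterAvoiding_of_adj_iff_empty hGr' hp hq]
  by_cases hS : exitAfterAvoiding Gr p q V = 0
  · have hAS : exitAfterAvoiding Gr p q (A ∪ V) = 0 :=
      le_antisymm (hS ▸ exitAfterAvoiding_mono Gr p q Set.subset_union_right)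
        (exitAfterAvoiding_nonneg Gr p q _)
    simp [hS, hAS]
  · rw [div_mul_div_comm, mul_comm (exitAfterAvoiding Gr p q ∅), ← div_mul_div_comm, div_self hS, one_mul]

/-! ### Finite coding by step sequences; symmetry of the killed Green function -/

section StepSeqs

variable {n : ℕ}

/-- The `n`-step sequences whose walk from `p` uses only `Gr`-edges and ends at `q`. [folklore] -/
def transitSeqs (Gr : SimpleGraph (Site d)) (n : ℕ) (p q : Site d) : Finset (StepSeq d n) :=
  Finset.univ.filter fun e => (∀ j < n, Gr.Adj (p + pos e j) (p + pos e (j + 1))) ∧ p + pos e n = q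

/-- `transitEvent` is the cylinder over `transitSeqs`. [folklore] -/
theorem transitEvent_eq_preimage (Gr : SimpleGraph (Site d)) (n : ℕ) (p q : Site d) :
    transitEvent Gr n p q = (fun (ω : PathSpace d) (l : Fin n) => ω l) ⁻¹' ↑(transitSeqs Gr n p q) := by
  ext ω
  simp only [transitEvent, transitSeqs, Set.mem_setOf_eq, Set.mem_preimage, Finset.coe_filter,
    Finset.mem_univ, true_and]
  rw [pos_restrict ω n le_rfl]
  refine and_congr_left fun _ => forall₂_congr fun j hj => ?_
  rw [pos_restrict ω n hj.le, pos_restrict ω n (Nat.succ_le_of_lt hj)]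

/-- **Counting formula**: `killedTrans Gr n p q = #transitSeqs / (2d)^n`. [folklore] -/
theorem killedTrans_eq_card [NeZero d] (Gr : SimpleGraph (Site d)) (n : ℕ) (p q : Site d) :
    killedTrans Gr n p q = ((transitSeqs Gr n p q).card : ℝ) / (2 * d : ℝ) ^ n := by
  rw [killedTrans_eq, transitEvent_eq_preimage, real_preimage_restrict]
  congr 2
  have : (↑(transitSeqs Gr n p q) : Set (StepSeq d n)).toFinite.toFinset = transitSeqs Gr n p q := by
    ext e; simp
  rw [this]

/-- Reversal of a step sequence: read backwards with every step negated. [folklore] -/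
def StepSeq.reverse (e : StepSeq d n) : StepSeq d n := fun i => (e (Fin.rev i)).neg

/-- Reversal is an involution. [folklore] -/
@[simp] theorem StepSeq.reverse_reverse (e : StepSeq d n) : StepSeq.reverse (StepSeq.reverse e) = e := by
  funext i; simp [StepSeq.reverse, Fin.rev_rev]

/-- Positions of the reversed walk: `rev(e)(k) = e(n-k) - e(n)` for `k ≤ n`. [folklore] -/
theorem pos_reverse (e : StepSeq d n) {k : ℕ} (hk : k ≤ n) :
    pos (StepSeq.reverse e) k = pos e (n - k) - endpoint e := by
  induction k with
  | zero => simp [pos_eq_endpoint]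
  | succ k ih =>
      have hkn : k < n := hk
      have hm : n - (k + 1) < n := by omega
      rw [pos_succ _ hkn, ih hkn.le]
      have h1 := pos_succ e hm
      rw [show n - (k + 1) + 1 = n - k by omega] at h1
      have h2 : (StepSeq.reverse e) ⟨k, hkn⟩ = (e ⟨n - (k + 1), hm⟩).neg := rfl
      rw [h2, stepVec_neg, h1]
      abel

/-- Reversal maps `Gr`-walks `p → q` to `Gr`-walks `q → p`. [folklore] -/
theorem reverse_mem_transitSeqs {Gr : SimpleGraph (Site d)} {p q : Site d} {e : StepSeq d n}
    (he : e ∈ transitSeqs Gr n p q) : StepSeq.reverse e ∈ transitSeqs Gr n q p := by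
  simp only [transitSeqs, Finset.mem_filter, Finset.mem_univ, true_and] at he ⊢
  obtain ⟨hadj, hend⟩ := he
  rw [pos_eq_endpoint] at hend
  have hpos : ∀ k ≤ n, q + pos (StepSeq.reverse e) k = p + pos e (n - k) := by
    intro k hk
    rw [pos_reverse e hk, ← hend]; abel
  refine ⟨fun j hj => ?_, ?_⟩
  · rw [hpos j hj.le, hpos (j + 1) (Nat.succ_le_of_lt hj)]
    have h := hadj (n - (j + 1)) (by omega)
    rw [show n - (j + 1) + 1 = n - j by omega] at h
    exact h.symm
  · rw [hpos n le_rfl, Nat.sub_self, pos_zero, add_zero]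

/-- `#transitSeqs` is symmetric in the endpoints (path reversal). [folklore] -/
theorem card_transitSeqs_comm (Gr : SimpleGraph (Site d)) (n : ℕ) (p q : Site d) :
    (transitSeqs Gr n p q).card = (transitSeqs Gr n q p).card :=
  Finset.card_bij' (fun e _ => StepSeq.reverse e) (fun e _ => StepSeq.reverse e)
    (fun _ he => reverse_mem_transitSeqs he) (fun _ he => reverse_mem_transitSeqs he)
    (fun e _ => StepSeq.reverse_reverse e) (fun e _ => StepSeq.reverse_reverse e)

end StepSeqs

/-- **Symmetry of the killed transition function**: `p_n(p,q) = p_n(q,p)`. [folklore] -/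
theorem killedTrans_comm [NeZero d] (Gr : SimpleGraph (Site d)) (n : ℕ) (p q : Site d) :
    killedTrans Gr n p q = killedTrans Gr n q p := by
  rw [killedTrans_eq_card, killedTrans_eq_card, card_transitSeqs_comm]

/-- **Symmetry of the killed Green function**: `G(p,q) = G(q,p)` (Lawler 1991, §1.5: "just
traverse the path backwards"). [folklore] -/
theorem killedGreen_comm [NeZero d] (Gr : SimpleGraph (Site d)) (p q : Site d) :
    killedGreen Gr p q = killedGreen Gr q p := by
  unfold killedGreen
  exact tsum_congr fun n => killedTrans_comm Gr n p q

/-! ### The Markov property at time `1` -/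

/-- The path with its first step removed. [folklore] -/
def tail (ω : PathSpace d) : PathSpace d := fun i => ω (i + 1)

/-- `tail ω i = ω (i+1)`. [folklore] -/
@[simp] theorem tail_apply (ω : PathSpace d) (i : ℕ) : tail ω i = ω (i + 1) := rfl

/-- `tail` is measurable. [folklore] -/
theorem measurable_tail : Measurable (tail : PathSpace d → PathSpace d) :=
  measurable_pi_lambda _ fun _ => measurable_pi_apply _

/-- **One step, then the rest**: `S_{j+1}(ω) = e_{ω 0} + S_j(tail ω)`. [folklore] -/
theorem S_succ_eq_stepVec_add (ω : PathSpace d) (j : ℕ) : S ω (j + 1) = stepVec (ω 0) + S (tail ω) j := by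
  unfold S incr
  rw [Finset.sum_range_succ', add_comm]
  rfl

/-- **The shifted path is again a simple random walk**: `tail` preserves `pathLaw`. [folklore] -/
theorem pathLaw_map_tail [NeZero d] : (pathLaw d).map tail = pathLaw d :=
  Measure.map_infinitePi_infinitePi_of_inj (P := fun _ : ℕ => stepLaw d) (f := fun i : ℕ => i + 1)
    fun _ _ h => Nat.succ_injective h

/-- Probabilities of shifted events. [folklore] -/
theorem real_preimage_tail [NeZero d] {B : Set (PathSpace d)} (hB : MeasurableSet B) :
    (pathLaw d).real (tail ⁻¹' B) = (pathLaw d).real B := by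
  rw [← map_measureReal_apply measurable_tail hB, pathLaw_map_tail]

/-- The law of the first step: `P(ω 0 = e) = (2d)⁻¹`. [folklore] -/
theorem real_head_eq [NeZero d] (e : Dir d) : (pathLaw d).real {ω : PathSpace d | ω 0 = e} = (2 * d : ℝ)⁻¹ := by
  have h : {ω : PathSpace d | ω 0 = e} = (fun ω : PathSpace d => ω 0) ⁻¹' {e} := rfl
  rw [h, ← map_measureReal_apply (measurable_pi_apply 0) (measurableSet_singleton e), pathLaw,
    Measure.infinitePi_map_eval, measureReal_def, stepLaw_singleton, ENNReal.toReal_inv,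
    ENNReal.toReal_natCast]
  push_cast; ring

/-- A shifted event determined by the steps in `K` is determined by the steps in `K + 1`.
[folklore] -/
theorem dependsOn_preimage_tail {B : Set (PathSpace d)} {K : Finset ℕ} (hB : DependsOn (· ∈ B) (K : Set ℕ)) :
    DependsOn (· ∈ tail ⁻¹' (B : Set (PathSpace d))) ((K.image fun k => k + 1 : Finset ℕ) : Set ℕ) := by
  intro ω ω' h
  show (tail ω ∈ B) = (tail ω' ∈ B)
  exact hB fun k hk => h (k + 1) (Finset.mem_coe.2 (Finset.mem_image.2 ⟨k, Finset.mem_coe.1 hk, rfl⟩))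

/-- **Markov property at time 1** (for finitely determined events): the first step and the shifted
path are independent, `P(ω 0 = e, tail ω ∈ B) = (2d)⁻¹ P(B)`. [folklore] -/
theorem real_head_inter_tail [NeZero d] (e : Dir d) {B : Set (PathSpace d)} {K : Finset ℕ}
    (hB : DependsOn (· ∈ B) (K : Set ℕ)) :
    (pathLaw d).real ({ω | ω 0 = e} ∩ tail ⁻¹' B) = (2 * d : ℝ)⁻¹ * (pathLaw d).real B := by
  have hhead : DependsOn (· ∈ {ω : PathSpace d | ω 0 = e}) (({0} : Finset ℕ) : Set ℕ) := by
    intro ω ω' h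
    show (ω 0 = e) = (ω' 0 = e)
    rw [h 0 (by simp)]
  have hdisj : Disjoint ({0} : Finset ℕ) (K.image fun k => k + 1) := by
    rw [Finset.disjoint_singleton_left, Finset.mem_image]
    rintro ⟨k, _, hk⟩
    exact Nat.succ_ne_zero k hk
  rw [real_inter_eq_of_dependsOn hdisj hhead (dependsOn_preimage_tail hB), real_head_eq,
    real_preimage_tail (measurableSet_of_dependsOn hB)]

/-- Partition by the first step: `P(E) = Σ_e P(ω 0 = e, E)`. [folklore] -/
theorem real_eq_sum_head_inter [NeZero d] {E : Set (PathSpace d)} (hE : MeasurableSet E) :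
    (pathLaw d).real E = ∑ e : Dir d, (pathLaw d).real ({ω | ω 0 = e} ∩ E) := by
  have hset : E = ⋃ e : Dir d, ({ω | ω 0 = e} ∩ E) := by
    ext ω
    simp only [Set.mem_iUnion, Set.mem_inter_iff, Set.mem_setOf_eq, exists_eq_left']
  conv_lhs => rw [hset]
  refine measureReal_iUnion_fintype (fun e e' hne => ?_) fun e =>
    (measurableSet_singleton e |>.preimage (measurable_pi_apply 0)).inter hE
  exact Set.disjoint_left.2 fun ω h h' => hne (h.1.symm.trans h'.1)

/-! ### First-step (discrete harmonicity) equations -/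

/-- `p_0(p,q) = [p = q]`. [folklore] -/
theorem killedTrans_zero [NeZero d] (Gr : SimpleGraph (Site d)) (p q : Site d) :
    killedTrans Gr 0 p q = if p = q then 1 else 0 := by
  unfold killedTrans
  by_cases hpq : p = q
  · rw [if_pos hpq]
    have : {ω : PathSpace d | (∀ j < 0, Gr.Adj (p + S ω j) (p + S ω (j + 1))) ∧ p + S ω 0 = q} = Set.univ := by
      ext ω; simp [hpq]
    rw [this, probReal_univ]
  · rw [if_neg hpq]
    have : {ω : PathSpace d | (∀ j < 0, Gr.Adj (p + S ω j) (p + S ω (j + 1))) ∧ p + S ω 0 = q} = ∅ := by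
      ext ω; simp [hpq]
    rw [this, measureReal_empty]

/-- First-step decomposition of `transitEvent (n+1)` on `{ω 0 = e}`. [folklore] -/
theorem head_inter_transitEvent_succ (Gr : SimpleGraph (Site d)) (n : ℕ) (p q : Site d) (e : Dir d) :
    {ω : PathSpace d | ω 0 = e} ∩ transitEvent Gr (n + 1) p q =
      if Gr.Adj p (p + stepVec e) then {ω | ω 0 = e} ∩ tail ⁻¹' transitEvent Gr n (p + stepVec e) q
      else ∅ := by
  ext ω
  simp only [transitEvent, Set.mem_inter_iff, Set.mem_setOf_eq]
  constructor
  · rintro ⟨rfl, hadj, hend⟩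
    have h0 := hadj 0 (Nat.succ_pos n)
    rw [S_zero, add_zero, S_succ_eq_stepVec_add, S_zero, add_zero] at h0
    rw [if_pos h0]
    refine ⟨rfl, fun j hj => ?_, ?_⟩
    · have h := hadj (j + 1) (by omega)
      rwa [S_succ_eq_stepVec_add, S_succ_eq_stepVec_add, ← add_assoc, ← add_assoc] at h
    · rwa [S_succ_eq_stepVec_add, ← add_assoc] at hend
  · intro h
    by_cases hadj : Gr.Adj p (p + stepVec e)
    · rw [if_pos hadj] at h
      obtain ⟨rfl, hadj', hend⟩ := h
      refine ⟨rfl, fun j hj => ?_, ?_⟩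
      · rcases j with _ | j
        · rwa [S_zero, add_zero, S_succ_eq_stepVec_add, S_zero, add_zero]
        · rw [S_succ_eq_stepVec_add, S_succ_eq_stepVec_add, ← add_assoc, ← add_assoc]
          exact hadj' j (by omega)
      · rw [S_succ_eq_stepVec_add, ← add_assoc]; exact hend
    · rw [if_neg hadj] at h
      exact absurd h (Set.notMem_empty ω)

/-- **First-step equation for the transition function**:
`p_{n+1}(p,q) = (2d)⁻¹ Σ_e [p ~ p+e in Gr] p_n(p+e,q)`. [folklore] -/
theorem killedTrans_succ [NeZero d] (Gr : SimpleGraph (Site d)) (n : ℕ) (p q : Site d) :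
    killedTrans Gr (n + 1) p q = (2 * d : ℝ)⁻¹ *
      ∑ e : Dir d, if Gr.Adj p (p + stepVec e) then killedTrans Gr n (p + stepVec e) q else 0 := by
  rw [killedTrans_eq, real_eq_sum_head_inter (measurableSet_transitEvent Gr (n + 1) p q), Finset.mul_sum]
  refine Finset.sum_congr rfl fun e _ => ?_
  rw [head_inter_transitEvent_succ]
  split_ifs with hadj
  · rw [real_head_inter_tail e (dependsOn_transitEvent Gr n (p + stepVec e) q), killedTrans_eq]
  · rw [measureReal_empty, mul_zero]

/-- First-step decomposition of `exitEvent (n+1)` on `{ω 0 = e}`. [folklore] -/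
theorem head_inter_exitEvent_succ (Gr : SimpleGraph (Site d)) (n : ℕ) (p q : Site d) (A : Set (Site d))
    (e : Dir d) :
    {ω : PathSpace d | ω 0 = e} ∩ exitEvent Gr (n + 1) p q A =
      if Gr.Adj p (p + stepVec e) ∧ p ∉ A then
        {ω | ω 0 = e} ∩ tail ⁻¹' exitEvent Gr n (p + stepVec e) q A
      else ∅ := by
  ext ω
  simp only [exitEvent, Set.mem_inter_iff, Set.mem_setOf_eq]
  constructor
  · rintro ⟨rfl, hadj, hkill, hend, havoid⟩
    have h0 := hadj 0 (Nat.succ_pos n)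
    rw [S_zero, add_zero, S_succ_eq_stepVec_add, S_zero, add_zero] at h0
    have hA := havoid 0 (Nat.zero_le _)
    rw [S_zero, add_zero] at hA
    rw [if_pos ⟨h0, hA⟩]
    refine ⟨rfl, fun j hj => ?_, ?_, ?_, fun j hj => ?_⟩
    · have h := hadj (j + 1) (by omega)
      rwa [S_succ_eq_stepVec_add, S_succ_eq_stepVec_add, ← add_assoc, ← add_assoc] at h
    · rwa [S_succ_eq_stepVec_add, S_succ_eq_stepVec_add, ← add_assoc, ← add_assoc] at hkill
    · rwa [S_succ_eq_stepVec_add, ← add_assoc] at hend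
    · have h := havoid (j + 1) (by omega)
      rwa [S_succ_eq_stepVec_add, ← add_assoc] at h
  · intro h
    by_cases hc : Gr.Adj p (p + stepVec e) ∧ p ∉ A
    · rw [if_pos hc] at h
      obtain ⟨rfl, hadj', hkill, hend, havoid⟩ := h
      refine ⟨rfl, fun j hj => ?_, ?_, ?_, fun j hj => ?_⟩
      · rcases j with _ | j
        · rw [S_zero, add_zero, S_succ_eq_stepVec_add, S_zero, add_zero]; exact hc.1
        · rw [S_succ_eq_stepVec_add, S_succ_eq_stepVec_add, ← add_assoc, ← add_assoc]
          exact hadj' j (by omega)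
      · rw [S_succ_eq_stepVec_add, S_succ_eq_stepVec_add, ← add_assoc, ← add_assoc]; exact hkill
      · rw [S_succ_eq_stepVec_add, ← add_assoc]; exact hend
      · rcases j with _ | j
        · rw [S_zero, add_zero]; exact hc.2
        · rw [S_succ_eq_stepVec_add, ← add_assoc]; exact havoid j (by omega)
    · rw [if_neg hc] at h
      exact absurd h (Set.notMem_empty ω)

/-- **First-step equation for `exitTrans`**:
`e_{n+1}(p,q,A) = [p ∉ A] (2d)⁻¹ Σ_e [p ~ p+e in Gr] e_n(p+e,q,A)`. [folklore] -/
theorem exitTrans_succ [NeZero d] (Gr : SimpleGraph (Site d)) (n : ℕ) (p q : Site d) (A : Set (Site d)) :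
    exitTrans Gr (n + 1) p q A = if p ∈ A then 0 else (2 * d : ℝ)⁻¹ *
      ∑ e : Dir d, if Gr.Adj p (p + stepVec e) then exitTrans Gr n (p + stepVec e) q A else 0 := by
  rw [exitTrans, real_eq_sum_head_inter (measurableSet_exitEvent Gr (n + 1) p q A)]
  split_ifs with hpA
  · refine Finset.sum_eq_zero fun e _ => ?_
    rw [head_inter_exitEvent_succ, if_neg (fun h => h.2 hpA), measureReal_empty]
  · rw [Finset.mul_sum]
    refine Finset.sum_congr rfl fun e _ => ?_
    rw [head_inter_exitEvent_succ]
    by_cases hadj : Gr.Adj p (p + stepVec e)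
    · rw [if_pos ⟨hadj, hpA⟩, if_pos hadj,
        real_head_inter_tail e (dependsOn_exitEvent Gr n (p + stepVec e) q A), exitTrans]
    · rw [if_neg (fun h => hadj h.1), if_neg hadj, measureReal_empty, mul_zero]

/-- The directions out of `p` that are not `Gr`-edges (killing directions). [folklore] -/
def killingDirs (Gr : SimpleGraph (Site d)) (p : Site d) : Finset (Dir d) :=
  Finset.univ.filter fun e => ¬ Gr.Adj p (p + stepVec e)

/-- `e_0(p,q,A) = [p = q, p ∉ A] · #killingDirs(p) / (2d)`: killed at the very first step.
[folklore] -/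
theorem exitTrans_zero [NeZero d] (Gr : SimpleGraph (Site d)) (p q : Site d) (A : Set (Site d)) :
    exitTrans Gr 0 p q A =
      if p = q ∧ p ∉ A then (2 * d : ℝ)⁻¹ * (killingDirs Gr p).card else 0 := by
  rw [exitTrans, real_eq_sum_head_inter (measurableSet_exitEvent Gr 0 p q A)]
  have hset : ∀ e : Dir d, {ω : PathSpace d | ω 0 = e} ∩ exitEvent Gr 0 p q A =
      if ¬ Gr.Adj p (p + stepVec e) ∧ p = q ∧ p ∉ A then {ω : PathSpace d | ω 0 = e} else ∅ := by
    intro e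
    ext ω
    simp only [exitEvent, Set.mem_inter_iff, Set.mem_setOf_eq, Nat.not_lt_zero, IsEmpty.forall_iff,
      implies_true, true_and, Nat.le_zero, forall_eq, S_zero, add_zero]
    constructor
    · rintro ⟨rfl, hkill, hend, havoid⟩
      rw [S_succ_eq_stepVec_add, S_zero, add_zero] at hkill
      rw [if_pos ⟨hkill, hend, havoid⟩]; rfl
    · intro h
      split_ifs at h with hc
      · refine ⟨h, ?_, hc.2.1, hc.2.2⟩
        rw [S_succ_eq_stepVec_add, S_zero, add_zero, show ω 0 = e from h]; exact hc.1
      · exact absurd h (Set.notMem_empty ω)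
  simp_rw [hset]
  by_cases hc : p = q ∧ p ∉ A
  · rw [if_pos hc, killingDirs, Finset.card_filter, Nat.cast_sum, Finset.mul_sum]
    refine Finset.sum_congr rfl fun e _ => ?_
    by_cases hadj : Gr.Adj p (p + stepVec e)
    · rw [if_neg (fun h => h.1 hadj), if_neg (not_not.2 hadj), measureReal_empty]; simp
    · rw [if_pos ⟨hadj, hc⟩, if_pos hadj, real_head_eq]; simp
  · rw [if_neg hc]
    refine Finset.sum_eq_zero fun e _ => ?_
    rw [if_neg (fun h => hc h.2), measureReal_empty]

/-- **First-step equation for the excursion functional** (discrete harmonicity in the start):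
`E(p,q,A) = [p ∉ A] · ([p = q] #killingDirs(q)/(2d) + (2d)⁻¹ Σ_e [p ~ p+e in Gr] E(p+e,q,A))`.
[folklore] -/
theorem exitAfterAvoiding_first_step [NeZero d] (Gr : SimpleGraph (Site d)) (p q : Site d) (A : Set (Site d)) :
    exitAfterAvoiding Gr p q A = if p ∈ A then 0 else
      (if p = q then (2 * d : ℝ)⁻¹ * (killingDirs Gr p).card else 0) + (2 * d : ℝ)⁻¹ *
        ∑ e : Dir d, if Gr.Adj p (p + stepVec e) then exitAfterAvoiding Gr (p + stepVec e) q A else 0 := by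
  rw [exitAfterAvoiding_eq_tsum, (summable_exitTrans Gr p q A).tsum_eq_zero_add, exitTrans_zero]
  simp_rw [exitTrans_succ]
  by_cases hpA : p ∈ A
  · simp [hpA]
  · simp only [hpA, not_false_eq_true, and_true, if_false]
    rw [tsum_mul_left, Summable.tsum_finsetSum]
    · congr 2
      refine Finset.sum_congr rfl fun e _ => ?_
      split_ifs with hadj
      · rw [exitAfterAvoiding_eq_tsum]
      · exact tsum_zero
    · intro e _
      split_ifs with hadj
      · exact summable_exitTrans Gr (p + stepVec e) q A
      · exact summable_zero

/-- **First-step equation for the killed Green function** (discrete harmonicity off the pole):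
if the series defining `G(x,q)` converge, `G(p,q) = [p = q] + (2d)⁻¹ Σ_e [p ~ p+e in Gr] G(p+e,q)`
(`G(·,q)` is discrete-harmonic for the killed walk off the pole; cf. Lawler 1991, §1.5).
[folklore] -/
theorem killedGreen_first_step [NeZero d] (Gr : SimpleGraph (Site d)) (p q : Site d)
    (hsum : ∀ x, Summable fun n => killedTrans Gr n x q) :
    killedGreen Gr p q = (if p = q then 1 else 0) + (2 * d : ℝ)⁻¹ *
      ∑ e : Dir d, if Gr.Adj p (p + stepVec e) then killedGreen Gr (p + stepVec e) q else 0 := by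
  rw [killedGreen, (hsum p).tsum_eq_zero_add, killedTrans_zero]
  simp_rw [killedTrans_succ]
  rw [tsum_mul_left, Summable.tsum_finsetSum]
  · congr 2
    refine Finset.sum_congr rfl fun e _ => ?_
    split_ifs with hadj
    · rfl
    · exact tsum_zero
  · intro e _
    split_ifs with hadj
    · exact hsum _
    · exact summable_zero

/-! ### Survival probabilities; summability of the killed Green function on finite graphs -/

/-- The event that the first `n` steps of the walk from `p` are `Gr`-edges (the killed walk
survives up to time `n`). [folklore] -/
def surviveEvent (Gr : SimpleGraph (Site d)) (n : ℕ) (p : Site d) : Set (PathSpace d) :=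
  {ω | ∀ j < n, Gr.Adj (p + S ω j) (p + S ω (j + 1))}

/-- The survival probability `P_p[the killed walk survives n steps]`. [folklore] -/
def survival [NeZero d] (Gr : SimpleGraph (Site d)) (n : ℕ) (p : Site d) : ℝ :=
  (pathLaw d).real (surviveEvent Gr n p)

/-- `transitEvent ⊆ surviveEvent`. [folklore] -/
theorem transitEvent_subset_surviveEvent (Gr : SimpleGraph (Site d)) (n : ℕ) (p q : Site d) :
    transitEvent Gr n p q ⊆ surviveEvent Gr n p := fun _ h => h.1

/-- `p_n(p,q) ≤ P_p[survive n]`. [folklore] -/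
theorem killedTrans_le_survival [NeZero d] (Gr : SimpleGraph (Site d)) (n : ℕ) (p q : Site d) :
    killedTrans Gr n p q ≤ survival Gr n p :=
  measureReal_mono (transitEvent_subset_surviveEvent Gr n p q)

/-- `surviveEvent Gr n p` depends only on the first `n` steps. [folklore] -/
theorem dependsOn_surviveEvent (Gr : SimpleGraph (Site d)) (n : ℕ) (p : Site d) :
    DependsOn (· ∈ surviveEvent Gr n p) (Finset.range n : Set ℕ) := by
  intro ω ω' h
  have h' : ∀ i < n, ω i = ω' i := fun i hi => h i (Finset.mem_coe.2 (Finset.mem_range.2 hi))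
  simp only [surviveEvent, Set.mem_setOf_eq]
  refine propext (forall₂_congr fun j hj => ?_)
  rw [S_congr h' hj.le, S_congr h' (Nat.succ_le_of_lt hj)]

/-- `surviveEvent` is measurable. [folklore] -/
theorem measurableSet_surviveEvent (Gr : SimpleGraph (Site d)) (n : ℕ) (p : Site d) :
    MeasurableSet (surviveEvent Gr n p) :=
  measurableSet_of_dependsOn (dependsOn_surviveEvent Gr n p)

/-- `0 ≤ P[survive n]`. [folklore] -/
theorem survival_nonneg [NeZero d] (Gr : SimpleGraph (Site d)) (n : ℕ) (p : Site d) :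
    0 ≤ survival Gr n p := measureReal_nonneg

/-- `P[survive n] ≤ 1`. [folklore] -/
theorem survival_le_one [NeZero d] (Gr : SimpleGraph (Site d)) (n : ℕ) (p : Site d) :
    survival Gr n p ≤ 1 := measureReal_le_one

/-- `P[survive 0] = 1`. [folklore] -/
theorem survival_zero [NeZero d] (Gr : SimpleGraph (Site d)) (p : Site d) : survival Gr 0 p = 1 := by
  have : surviveEvent Gr 0 p = Set.univ := by ext ω; simp [surviveEvent]
  rw [survival, this, probReal_univ]

/-- Survival probabilities decrease in time. [folklore] -/
theorem survival_antitone [NeZero d] (Gr : SimpleGraph (Site d)) (p : Site d) {m n : ℕ} (hmn : m ≤ n) :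
    survival Gr n p ≤ survival Gr m p :=
  measureReal_mono fun _ h j hj => h j (lt_of_lt_of_le hj hmn)

/-- First-step decomposition of `surviveEvent (n+1)` on `{ω 0 = e}`. [folklore] -/
theorem head_inter_surviveEvent_succ (Gr : SimpleGraph (Site d)) (n : ℕ) (p : Site d) (e : Dir d) :
    {ω : PathSpace d | ω 0 = e} ∩ surviveEvent Gr (n + 1) p =
      if Gr.Adj p (p + stepVec e) then {ω | ω 0 = e} ∩ tail ⁻¹' surviveEvent Gr n (p + stepVec e)
      else ∅ := by
  ext ω
  simp only [surviveEvent, Set.mem_inter_iff, Set.mem_setOf_eq]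
  constructor
  · rintro ⟨rfl, hadj⟩
    have h0 := hadj 0 (Nat.succ_pos n)
    rw [S_zero, add_zero, S_succ_eq_stepVec_add, S_zero, add_zero] at h0
    rw [if_pos h0]
    refine ⟨rfl, fun j hj => ?_⟩
    have h := hadj (j + 1) (by omega)
    rwa [S_succ_eq_stepVec_add, S_succ_eq_stepVec_add, ← add_assoc, ← add_assoc] at h
  · intro h
    by_cases hadj : Gr.Adj p (p + stepVec e)
    · rw [if_pos hadj] at h
      obtain ⟨rfl, hadj'⟩ := h
      refine ⟨rfl, fun j hj => ?_⟩
      rcases j with _ | j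
      · rwa [S_zero, add_zero, S_succ_eq_stepVec_add, S_zero, add_zero]
      · rw [S_succ_eq_stepVec_add, S_succ_eq_stepVec_add, ← add_assoc, ← add_assoc]
        exact hadj' j (by omega)
    · rw [if_neg hadj] at h
      exact absurd h (Set.notMem_empty ω)

/-- **First-step equation for survival probabilities**:
`P_p[survive n+1] = (2d)⁻¹ Σ_e [p ~ p+e in Gr] P_{p+e}[survive n]`. [folklore] -/
theorem survival_succ [NeZero d] (Gr : SimpleGraph (Site d)) (n : ℕ) (p : Site d) :
    survival Gr (n + 1) p = (2 * d : ℝ)⁻¹ *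
      ∑ e : Dir d, if Gr.Adj p (p + stepVec e) then survival Gr n (p + stepVec e) else 0 := by
  rw [survival, real_eq_sum_head_inter (measurableSet_surviveEvent Gr (n + 1) p), Finset.mul_sum]
  refine Finset.sum_congr rfl fun e _ => ?_
  rw [head_inter_surviveEvent_succ]
  split_ifs with hadj
  · rw [real_head_inter_tail e (dependsOn_surviveEvent Gr n (p + stepVec e)), survival]
  · rw [measureReal_empty, mul_zero]

/-- **Sub-multiplicativity of survival** (Markov property): a uniform bound
`P_y[survive n] ≤ C` propagates to `P_x[survive n + m] ≤ P_x[survive m] · C`. [folklore] -/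
theorem survival_add_le [NeZero d] (Gr : SimpleGraph (Site d)) {n : ℕ} {C : ℝ}
    (hn : ∀ y, survival Gr n y ≤ C) (m : ℕ) (x : Site d) :
    survival Gr (n + m) x ≤ survival Gr m x * C := by
  induction m generalizing x with
  | zero => rw [Nat.add_zero, survival_zero, one_mul]; exact hn x
  | succ m ih =>
      rw [← Nat.add_assoc, survival_succ, survival_succ, mul_assoc, Finset.sum_mul]
      refine mul_le_mul_of_nonneg_left (Finset.sum_le_sum fun e _ => ?_) (by positivity)
      split_ifs with hadj
      · exact ih _
      · rw [zero_mul]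

section SurviveSeqs

variable {n : ℕ}

/-- The `n`-step sequences whose walk from `p` uses only `Gr`-edges. [folklore] -/
def surviveSeqs (Gr : SimpleGraph (Site d)) (n : ℕ) (p : Site d) : Finset (StepSeq d n) :=
  Finset.univ.filter fun e => ∀ j < n, Gr.Adj (p + pos e j) (p + pos e (j + 1))

/-- `surviveEvent` is the cylinder over `surviveSeqs`. [folklore] -/
theorem surviveEvent_eq_preimage (Gr : SimpleGraph (Site d)) (n : ℕ) (p : Site d) :
    surviveEvent Gr n p = (fun (ω : PathSpace d) (l : Fin n) => ω l) ⁻¹' ↑(surviveSeqs Gr n p) := by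
  ext ω
  simp only [surviveEvent, surviveSeqs, Set.mem_setOf_eq, Set.mem_preimage, Finset.coe_filter,
    Finset.mem_univ, true_and]
  refine forall₂_congr fun j hj => ?_
  rw [pos_restrict ω n hj.le, pos_restrict ω n (Nat.succ_le_of_lt hj)]

/-- **Counting formula**: `P_p[survive n] = #surviveSeqs / (2d)^n`. [folklore] -/
theorem survival_eq_card [NeZero d] (Gr : SimpleGraph (Site d)) (n : ℕ) (p : Site d) :
    survival Gr n p = ((surviveSeqs Gr n p).card : ℝ) / (2 * d : ℝ) ^ n := by
  rw [survival, surviveEvent_eq_preimage, real_preimage_restrict]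
  congr 2
  have : (↑(surviveSeqs Gr n p) : Set (StepSeq d n)).toFinite.toFinset = surviveSeqs Gr n p := by
    ext e; simp
  rw [this]

/-- Positions of the straight walk `e₀, e₀, …` (all steps in the first positive direction): its
first coordinate increases by one at each step. [folklore] -/
theorem pos_const_apply_zero (hd : 0 < d) (n : ℕ) {j : ℕ} (hj : j ≤ n) :
    pos (fun _ : Fin n => ((⟨0, hd⟩ : Fin d), true)) j ⟨0, hd⟩ = j := by
  induction j with
  | zero => simp
  | succ j ih =>
      rw [pos_succ _ (Nat.lt_of_succ_le hj), Pi.add_apply, ih (Nat.le_of_succ_le hj), stepVec_apply]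
      simp

/-- **Uniform escape**: if `Gr` has finitely many non-isolated vertices, say `|support| < N`, then
from every start the killed walk dies within `N` steps with probability at least `(2d)^{-N}`
(walk straight in one direction). [folklore] -/
theorem survival_le_of_finite_support [NeZero d] {Gr : SimpleGraph (Site d)} (hfin : Gr.support.Finite)
    {N : ℕ} (hN : hfin.toFinset.card < N) (p : Site d) :
    survival Gr N p ≤ 1 - ((2 * d : ℝ) ^ N)⁻¹ := by
  have hd : 0 < d := Nat.pos_of_ne_zero (NeZero.ne d)
  set c : StepSeq d N := fun _ => ((⟨0, hd⟩ : Fin d), true) with hc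
  -- the straight walk does not survive `N` steps
  have hc_not : c ∉ surviveSeqs Gr N p := by
    intro hmem
    simp only [surviveSeqs, Finset.mem_filter, Finset.mem_univ, true_and] at hmem
    have hinj : Set.InjOn (fun j : ℕ => p + pos c j) ↑(Finset.range N) := by
      intro j hj j' hj' h
      have h0 := congrFun h ⟨0, hd⟩
      simp only [Pi.add_apply] at h0
      rw [pos_const_apply_zero hd N (Finset.mem_range.1 (Finset.mem_coe.1 hj)).le,
        pos_const_apply_zero hd N (Finset.mem_range.1 (Finset.mem_coe.1 hj')).le] at h0
      exact_mod_cast add_left_cancel h0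
    have hmaps : ∀ j ∈ Finset.range N, p + pos c j ∈ hfin.toFinset := by
      intro j hj
      rw [Set.Finite.mem_toFinset, SimpleGraph.mem_support]
      exact ⟨_, hmem j (Finset.mem_range.1 hj)⟩
    have := Finset.card_le_card_of_injOn _ hmaps hinj
    rw [Finset.card_range] at this
    omega
  have hcard : (surviveSeqs Gr N p).card ≤ (2 * d) ^ N - 1 := by
    have h1 : surviveSeqs Gr N p ⊆ Finset.univ.erase c :=
      fun e he => Finset.mem_erase.2 ⟨fun h => hc_not (h ▸ he), Finset.mem_univ e⟩
    have h2 := Finset.card_le_card h1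
    rwa [Finset.card_erase_of_mem (Finset.mem_univ c), Finset.card_univ, card_stepSeq] at h2
  have hpos : (0 : ℝ) < (2 * d : ℝ) ^ N := by positivity
  have hone : (1 : ℝ) ≤ (2 * d : ℝ) ^ N := one_le_pow₀ (by
    have : (1 : ℝ) ≤ d := by exact_mod_cast hd
    linarith)
  rw [survival_eq_card, div_le_iff₀ hpos, sub_mul, one_mul, inv_mul_cancel₀ hpos.ne']
  have h : ((surviveSeqs Gr N p).card : ℝ) ≤ ((2 * d) ^ N - 1 : ℕ) := by exact_mod_cast hcard
  refine h.trans ?_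
  rw [Nat.cast_sub (by exact_mod_cast hone), Nat.cast_pow, Nat.cast_mul, Nat.cast_ofNat, Nat.cast_one]

end SurviveSeqs

/-- **Geometric decay of survival** on a graph with finitely many non-isolated vertices:
`P_x[survive N k] ≤ θ^k` with `θ = 1 - (2d)^{-N}`, `N = |support| + 1`. [folklore] -/
theorem survival_mul_le_pow [NeZero d] {Gr : SimpleGraph (Site d)} (hfin : Gr.support.Finite)
    {N : ℕ} (hN : hfin.toFinset.card < N) (k : ℕ) (x : Site d) :
    survival Gr (N * k) x ≤ (1 - ((2 * d : ℝ) ^ N)⁻¹) ^ k := by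
  have hθ : 0 ≤ 1 - ((2 * d : ℝ) ^ N)⁻¹ := by
    have hd : 0 < d := Nat.pos_of_ne_zero (NeZero.ne d)
    have hone : (1 : ℝ) ≤ (2 * d : ℝ) ^ N := one_le_pow₀ (by
      have : (1 : ℝ) ≤ d := by exact_mod_cast hd
      linarith)
    rw [sub_nonneg]
    exact inv_le_one_of_one_le₀ hone
  induction k generalizing x with
  | zero => rw [Nat.mul_zero, survival_zero, pow_zero]
  | succ k ih =>
      rw [Nat.mul_succ, pow_succ']
      calc survival Gr (N * k + N) x ≤ survival Gr N x * (1 - ((2 * d : ℝ) ^ N)⁻¹) ^ k :=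
            survival_add_le Gr ih N x
        _ ≤ (1 - ((2 * d : ℝ) ^ N)⁻¹) * (1 - ((2 * d : ℝ) ^ N)⁻¹) ^ k :=
            mul_le_mul_of_nonneg_right (survival_le_of_finite_support hfin hN x) (pow_nonneg hθ k)

/-- **Summability of survival probabilities** on a graph with finitely many non-isolated vertices
(the killed walk has a finite expected lifetime). [folklore] -/
theorem summable_survival_of_finite_support [NeZero d] {Gr : SimpleGraph (Site d)}
    (hfin : Gr.support.Finite) (p : Site d) : Summable fun n => survival Gr n p := by
  obtain ⟨N, hNlt⟩ : ∃ N : ℕ, hfin.toFinset.card < N := ⟨_, Nat.lt_succ_self _⟩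
  have hNpos : 0 < N := lt_of_le_of_lt (Nat.zero_le _) hNlt
  set θ : ℝ := 1 - ((2 * d : ℝ) ^ N)⁻¹ with hθdef
  have hd : 0 < d := Nat.pos_of_ne_zero (NeZero.ne d)
  have hone : (1 : ℝ) ≤ (2 * d : ℝ) ^ N := one_le_pow₀ (by
    have : (1 : ℝ) ≤ d := by exact_mod_cast hd
    linarith)
  have hθ0 : 0 ≤ θ := by rw [hθdef, sub_nonneg]; exact inv_le_one_of_one_le₀ hone
  have hθ1 : θ < 1 := by rw [hθdef, sub_lt_self_iff]; positivity
  have hgeom := summable_geometric_of_lt_one hθ0 hθ1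
  -- partial sums over blocks of length `N`
  have hblock : ∀ K, ∑ i ∈ Finset.range (N * K), survival Gr i p ≤ N * ∑ k ∈ Finset.range K, θ ^ k := by
    intro K
    induction K with
    | zero => simp
    | succ K ih =>
        rw [Nat.mul_succ, Finset.sum_range_add, Finset.sum_range_succ (fun k => θ ^ k), mul_add]
        refine add_le_add ih ?_
        calc ∑ r ∈ Finset.range N, survival Gr (N * K + r) p ≤ ∑ r ∈ Finset.range N, θ ^ K :=
              Finset.sum_le_sum fun r _ =>
                (survival_antitone Gr p (Nat.le_add_right _ _)).trans (survival_mul_le_pow hfin hNlt K p)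
          _ = N * θ ^ K := by rw [Finset.sum_const, Finset.card_range, nsmul_eq_mul]
  refine summable_of_sum_range_le (c := N * (1 - θ)⁻¹) (fun n => survival_nonneg Gr n p) fun n => ?_
  calc ∑ i ∈ Finset.range n, survival Gr i p ≤ ∑ i ∈ Finset.range (N * n), survival Gr i p :=
        Finset.sum_le_sum_of_subset_of_nonneg
          (Finset.range_subset_range.2 (Nat.le_mul_of_pos_left n hNpos))
          fun i _ _ => survival_nonneg Gr i p
    _ ≤ N * ∑ k ∈ Finset.range n, θ ^ k := hblock n
    _ ≤ N * (1 - θ)⁻¹ := by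
        refine mul_le_mul_of_nonneg_left ?_ (Nat.cast_nonneg _)
        rw [← tsum_geometric_of_lt_one hθ0 hθ1]
        exact hgeom.sum_le_tsum (Finset.range n) fun k _ => pow_nonneg hθ0 k

/-- **The killed Green function converges on a graph with finitely many non-isolated vertices**
(e.g. the discretisation `discreteDomainGraph Ω δ` of a bounded domain, or that graph with a
vertex set deleted). [folklore] -/
theorem summable_killedTrans_of_finite_support [NeZero d] {Gr : SimpleGraph (Site d)}
    (hfin : Gr.support.Finite) (p q : Site d) : Summable fun n => killedTrans Gr n p q :=
  (summable_survival_of_finite_support hfin p).of_nonneg_of_le (fun n => killedTrans_nonneg Gr n p q)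
    fun n => killedTrans_le_survival Gr n p q

/-- **First-step equation for the killed Green function of a graph with finitely many
non-isolated vertices** (no summability hypothesis):
`G(p,q) = [p = q] + (2d)⁻¹ Σ_e [p ~ p+e in Gr] G(p+e,q)`. [folklore] -/
theorem killedGreen_first_step_of_finite_support [NeZero d] {Gr : SimpleGraph (Site d)}
    (hfin : Gr.support.Finite) (p q : Site d) :
    killedGreen Gr p q = (if p = q then 1 else 0) + (2 * d : ℝ)⁻¹ *
      ∑ e : Dir d, if Gr.Adj p (p + stepVec e) then killedGreen Gr (p + stepVec e) q else 0 :=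
  killedGreen_first_step Gr p q fun x => summable_killedTrans_of_finite_support hfin x q

/-- On such a graph the killed Green function dominates each of its terms; in particular
`G(p,p) ≥ 1`. [folklore] -/
theorem killedTrans_le_killedGreen [NeZero d] {Gr : SimpleGraph (Site d)} (hfin : Gr.support.Finite)
    (n : ℕ) (p q : Site d) : killedTrans Gr n p q ≤ killedGreen Gr p q :=
  (summable_killedTrans_of_finite_support hfin p q).le_tsum n fun m _ => killedTrans_nonneg Gr m p q

/-- `G(p,p) ≥ 1` on a graph with finitely many non-isolated vertices. [folklore] -/
theorem one_le_killedGreen_self [NeZero d] {Gr : SimpleGraph (Site d)} (hfin : Gr.support.Finite)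
    (p : Site d) : 1 ≤ killedGreen Gr p p := by
  have h := killedTrans_le_killedGreen hfin 0 p p
  rwa [killedTrans_zero, if_pos rfl] at h

/-! ### Positivity along `Gr`-walks -/

/-- If `Gr` is a subgraph of the nearest-neighbour graph and `w` is a `Gr`-walk from `p` to `q`,
the killed walk follows `w` with probability `(2d)^{-|w|}`, so `p_{|w|}(p,q) > 0`. [folklore] -/
theorem killedTrans_length_pos_of_walk [NeZero d] {Gr : SimpleGraph (Site d)} (hGr : Gr ≤ zdGraph d)
    {p q : Site d} (w : Gr.Walk p q) : 0 < killedTrans Gr w.length p q := by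
  have hd : (0 : ℝ) < (2 * d : ℝ)⁻¹ := by
    have : (0 : ℝ) < d := Nat.cast_pos.2 (Nat.pos_of_ne_zero (NeZero.ne d))
    positivity
  induction w with
  | nil => rw [SimpleGraph.Walk.length_nil, killedTrans_zero, if_pos rfl]; exact one_pos
  | @cons u v x hadj w' ih =>
      obtain ⟨e₀, rfl⟩ := exists_dir_of_adj (hGr hadj)
      rw [SimpleGraph.Walk.length_cons, killedTrans_succ]
      refine mul_pos hd (lt_of_lt_of_le ?_ (Finset.single_le_sum (f := fun e : Dir d =>
        if Gr.Adj u (u + stepVec e) then killedTrans Gr w'.length (u + stepVec e) x else 0)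
        (fun e _ => ?_) (Finset.mem_univ e₀)))
      · simp only [if_pos hadj]; exact ih
      · split_ifs
        · exact killedTrans_nonneg _ _ _ _
        · exact le_rfl

/-- **The killed Green function is positive between `Gr`-connected points** (for `Gr` a subgraph
of the nearest-neighbour graph with finitely many non-isolated vertices) — e.g. the factors of the
random-walk cross-ratio of route `SAWExcursionCardy` under its `Reachable` hypothesis. [folklore] -/
theorem killedGreen_pos_of_reachable [NeZero d] {Gr : SimpleGraph (Site d)} (hGr : Gr ≤ zdGraph d)
    (hfin : Gr.support.Finite) {p q : Site d} (h : Gr.Reachable p q) : 0 < killedGreen Gr p q := by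
  obtain ⟨w⟩ := h
  exact (killedTrans_length_pos_of_walk hGr w).trans_le (killedTrans_le_killedGreen hfin _ p q)

/-! ### Application to the lattice domains of the route -/

/-- Deleting vertices does not create non-isolated vertices: the support of the slit graph is
contained in the support of `Gr`. [folklore] -/
theorem support_fromRel_and_notMem_subset (Gr : SimpleGraph (Site d)) (V : Set (Site d)) :
    (SimpleGraph.fromRel fun x y => Gr.Adj x y ∧ x ∉ V ∧ y ∉ V).support ⊆ Gr.support := by
  intro x hx
  obtain ⟨y, hy⟩ := (SimpleGraph.mem_support _).1 hx
  exact (SimpleGraph.mem_support _).2 ⟨y, ((fromRel_adj_and_notMem_iff Gr V x y).1 hy).1⟩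

/-- The non-isolated vertices of `Ω_δ = discreteDomainGraph Ω δ` lie in `meshDomain Ω δ`.
[folklore] -/
theorem support_discreteDomainGraph_subset (Ω : Set ℂ) (δ : ℝ) :
    (discreteDomainGraph Ω δ).support ⊆ meshDomain Ω δ := by
  intro x hx
  obtain ⟨y, hy⟩ := (SimpleGraph.mem_support _).1 hx
  exact (discreteDomainGraph_adj_iff.1 hy).2.1

/-- For a bounded domain and a positive mesh, `Ω_δ` has finitely many non-isolated vertices, so
`summable_killedTrans_of_finite_support` and `killedGreen_first_step_of_finite_support` apply to
`discreteDomainGraph Ω δ` and (by `support_fromRel_and_notMem_subset`) to its slit subgraphs.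
[folklore] -/
theorem finite_support_discreteDomainGraph {Ω : Set ℂ} {δ : ℝ} (hΩ : Bornology.IsBounded Ω) (hδ : 0 < δ) :
    (discreteDomainGraph Ω δ).support.Finite :=
  (meshDomain_finite hΩ hδ).subset (support_discreteDomainGraph_subset Ω δ)

end SRW

end Literature.Probability.LatticeModels
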